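/-
Copyright (c) 2026 the pub-hodgecm-mathlib formalisation cell (harness21).  Prover seat hodgecm-mathlib-K2E1-p09 (g4), Track B ∕ K2-LIT,
h413 = `stmt-HodgeConjecture-24833`, line `K2_E1_TraceFormulaBeta`, campaign RES-RANK-ONE, page «EIS-RANK-ONE» (standing orders K2E1-plan (g2) 04:04:57Z (ii)): the
Eisenstein constant term «`E_B(φ) = φ + M(w₀)φ`» INSTANTIATED on Mok's quasi-split `U(J₂)`, `U(J₃)` (design ruling 04:01:46Z: `quasiSplit` currency).
-/
import Summits.HodgeConjecture.HodgeConjecture.Theorems.K2E1EisensteinConstantTerm        -- ★ (this seat): the generic `[0,∞]` ∕ `ℂ` formulas over `Γ ⧸ B_Γ`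
import Summits.HodgeConjecture.HodgeConjecture.Theorems.K2E1PseudoEisensteinConstantTermU   -- ★ p857274 (this seat): §1 transport through `ι = toAdelic`
import HarnessLib

/-!
# h413 ∕ Track B «K2-LIT», page EIS-RANK-ONE — helper `K2E1EisensteinConstantTermU`: the rank-one Eisenstein constant term on Mok's `U(J₂)`, `U(J₃)`:
# `∫_{N(F)\N(𝔸)} E_φ(x u⁻¹) du = ν(𝓕)·φ(x) + ∫_{N(𝔸)} φ(x v ι(J_N)⁻¹) dv`

Cell `pub/hodgecm-mathlib`, crux H413 = `stmt-HodgeConjecture-24833`, route `HCCMUnconditional`; chair K2-lead (g0).  THEOREMS ONLY (no `def`, no `instance`, no `notation`,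
no named-fact hypothesis, no `sorry`); lane `--kind proof --supports stmt-HodgeConjecture-24833 --as helper` (count-neutral).

* §1 **`bruhat_quotientSubgroup_of_rational`** (every `N`, EXPORTED for reuse): the Bruhat trichotomy INSIDE `Γ = G(F) ≤ U(J_N)(𝔸_F)` — `B(F) = borelAdelic ⊓ Γ`,
  `N(F) = adelicUnipotent ⊓ Γ`, `w₀ = ι(w)` — from the RATIONAL trichotomy on `U(J_N)(F) ≤ GL_N(E)` (★ `U2LocalBruhatDecomposition` ∕ ★ `U3LocalBruhatDecompositionProofs`), by the
  transport lemmas of ★ p857274 §1;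
* §2 **`setLIntegral_tsum_borelQuotient_eq_quasiSplit_of_rational`** ∕ **`setIntegral_tsum_borelQuotient_eq_quasiSplit_of_rational`** (every `N`, `[0,∞]` ∕ `ℂ`): the ★
  `K2E1EisensteinConstantTerm` formulas with the coset form supplied by §1 + ★ `exists_equiv_option_quotient_borel`;
* §3 the instances **`…_two`**, **`…_three`** on `U(J₂)`, `U(J₃)` (any `E∕F`, any `c`): for a Borel `φ : U(J_N)(𝔸_F) → [0,∞]` (resp. `ℂ` under `∫⁻_𝓕 E_{‖φ‖} < ∞`)
  right-invariant under `N(𝔸_F)` and under `B(F)`, every left- and inversion-invariant `ν` on `N(𝔸_F)`, every measurable fundamental domain `𝓕` of `N(F)`, every `x`: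
  `∫⁻_{u∈𝓕} E_φ(x u⁻¹) dν = ν(𝓕)·φ(x) + ∫⁻_{N(𝔸)} φ(x v ι(J_N)⁻¹) dν(v)` [MW1995 II.1.7] — the shape `E(φ_s)_B = φ_s + M(s)φ_s` that the intertwining-operator ∕ (H4-b) files consume.

HONEST LABEL.  Count-neutral helper; proves no printed statement; HC_CM is proved only modulo the 7 printed citations (2 remaining named inputs: hLiu418 =
`stmt-HodgeConjecture-24832`, h413 = `stmt-HodgeConjecture-24833`) until rung 0 closes.

## References
* [MoeglinWaldspurger1995] C. Mœglin, J.-L. Waldspurger, *Spectral decomposition and Eisenstein series* (1995), II.1.7.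
* [Rogawski1990] J. D. Rogawski, *Automorphic Representations of Unitary Groups in Three Variables* (1990), §1.10, §2.1–§2.2.
* [GetzHahn2024] J. R. Getz, H. Hahn, *An Introduction to Automorphic Representations* (2024), §10.4.
-/

set_option autoImplicit false
set_option linter.dupNamespace false  -- the mandated namespace repeats the summit's segment (`HodgeConjecture.HodgeConjecture`)

noncomputable section
open MeasureTheory Measure Set Filter Topology NumberField IsDedekindDomain Matrix
open Literature.NumberTheory.Automorphic Literature.NumberTheory.Automorphic.UnitaryGroup AdelicGroupData
open Summit.HodgeConjecture.HodgeConjecture.Cruxes.H413.K2E1EisensteinConstantTerm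
open Summit.HodgeConjecture.HodgeConjecture.Cruxes.H413.K2E1PseudoEisensteinConstantTermU
open scoped ENNReal NNReal Pointwise MatrixGroups

namespace Summit.HodgeConjecture.HodgeConjecture.Cruxes.H413.K2E1EisensteinConstantTermU

variable {F E : Type} [Field F] [NumberField F] [Field E] [NumberField E] [Algebra F E] {c : E ≃ₐ[F] E} {N : ℕ}

/-! ## §1 The Bruhat trichotomy inside `Γ = G(F) ≤ U(J_N)(𝔸_F)`, transported from the rational group -/

section Bruhat

/-- **THE BRUHAT TRICHOTOMY INSIDE `Γ = G(F) ≤ U(J_N)(𝔸_F)`** (every `N`): if `w ∈ U(J_N)(F)` satisfies `U(J_N)(F) = B ⊔ B·w·N` for the upper-triangular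
`B = borelU`, `N = unipotentU` (existence, disjointness, unique coordinates), then the same three statements hold in `Γ = quotientSubgroup` for `B(F) = borelAdelic ⊓ Γ`,
`N(F) = adelicUnipotent ⊓ Γ` and `w₀ = ι(w)` (★ p857274 §1: `ι` is injective, multiplicative, onto `Γ`, and detects `B` and `N`). [cite: Rogawski1990, §1.10, §2.1] -/
theorem bruhat_quotientSubgroup_of_rational (w : ↥(unitaryGroupOfForm (c : E →+* E) ((StdForm.antidiagonal N).over E)))
    (hexR : ∀ g : ↥(unitaryGroupOfForm (c : E →+* E) ((StdForm.antidiagonal N).over E)),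
      g ∈ borelU (c : E →+* E) ((StdForm.antidiagonal N).over E) ∨ ∃ b ∈ borelU (c : E →+* E) ((StdForm.antidiagonal N).over E),
        ∃ n ∈ unipotentU (c : E →+* E) ((StdForm.antidiagonal N).over E), g = b * w * n)
    (hdisjR : ∀ ⦃b n : ↥(unitaryGroupOfForm (c : E →+* E) ((StdForm.antidiagonal N).over E))⦄, b ∈ borelU (c : E →+* E) ((StdForm.antidiagonal N).over E) →
      n ∈ unipotentU (c : E →+* E) ((StdForm.antidiagonal N).over E) → b * w * n ∉ borelU (c : E →+* E) ((StdForm.antidiagonal N).over E))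
    (huniqR : ∀ ⦃b b' n n' : ↥(unitaryGroupOfForm (c : E →+* E) ((StdForm.antidiagonal N).over E))⦄,
      b ∈ borelU (c : E →+* E) ((StdForm.antidiagonal N).over E) → b' ∈ borelU (c : E →+* E) ((StdForm.antidiagonal N).over E) →
      n ∈ unipotentU (c : E →+* E) ((StdForm.antidiagonal N).over E) → n' ∈ unipotentU (c : E →+* E) ((StdForm.antidiagonal N).over E) →
      b * w * n = b' * w * n' → b = b' ∧ n = n') :
    (∀ γ : (quasiSplit F E c N).quotientSubgroup, γ ∈ (borelAdelic F E c N).subgroupOf (quasiSplit F E c N).quotientSubgroup ∨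
      ∃ b ∈ (borelAdelic F E c N).subgroupOf (quasiSplit F E c N).quotientSubgroup, ∃ n ∈ (adelicUnipotent F E c N).subgroupOf (quasiSplit F E c N).quotientSubgroup,
        γ = b * ⟨(quasiSplit F E c N).toAdelic w, toAdelic_mem_quotientSubgroup w⟩ * n) ∧
    (∀ ⦃b n : (quasiSplit F E c N).quotientSubgroup⦄, b ∈ (borelAdelic F E c N).subgroupOf (quasiSplit F E c N).quotientSubgroup →
      n ∈ (adelicUnipotent F E c N).subgroupOf (quasiSplit F E c N).quotientSubgroup →
        b * ⟨(quasiSplit F E c N).toAdelic w, toAdelic_mem_quotientSubgroup w⟩ * n ∉ (borelAdelic F E c N).subgroupOf (quasiSplit F E c N).quotientSubgroup) ∧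
    (∀ ⦃b b' n n' : (quasiSplit F E c N).quotientSubgroup⦄, b ∈ (borelAdelic F E c N).subgroupOf (quasiSplit F E c N).quotientSubgroup →
      b' ∈ (borelAdelic F E c N).subgroupOf (quasiSplit F E c N).quotientSubgroup → n ∈ (adelicUnipotent F E c N).subgroupOf (quasiSplit F E c N).quotientSubgroup →
      n' ∈ (adelicUnipotent F E c N).subgroupOf (quasiSplit F E c N).quotientSubgroup →
        b * ⟨(quasiSplit F E c N).toAdelic w, toAdelic_mem_quotientSubgroup w⟩ * n = b' * ⟨(quasiSplit F E c N).toAdelic w, toAdelic_mem_quotientSubgroup w⟩ * n' →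
          b = b' ∧ n = n') := by
  refine ⟨fun γ => ?_, fun b n hb hn h => ?_, fun b b' n n' hb hb' hn hn' h => ?_⟩
  · obtain ⟨g, hg⟩ := exists_toAdelic_eq_of_mem_quotientSubgroup γ
    rcases hexR g with hB | ⟨b, hb, n, hn, hgeq⟩
    · left
      rw [Subgroup.mem_subgroupOf, ← hg]
      exact (K2E1PseudoEisensteinConstantTermU.toAdelic_mem_borelAdelic_iff g).2 hB
    · right
      refine ⟨⟨(quasiSplit F E c N).toAdelic b, toAdelic_mem_quotientSubgroup b⟩, ?_, ⟨(quasiSplit F E c N).toAdelic n, toAdelic_mem_quotientSubgroup n⟩, ?_, ?_⟩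
      · rw [Subgroup.mem_subgroupOf]; exact (K2E1PseudoEisensteinConstantTermU.toAdelic_mem_borelAdelic_iff b).2 hb
      · rw [Subgroup.mem_subgroupOf]; exact (toAdelic_mem_adelicUnipotent_iff n).2 hn
      · apply Subtype.ext
        change (γ : (quasiSplit F E c N).Adelic) = (quasiSplit F E c N).toAdelic b * (quasiSplit F E c N).toAdelic w * (quasiSplit F E c N).toAdelic n
        rw [← hg, hgeq, toAdelic_mul_quasiSplit, toAdelic_mul_quasiSplit]
  · obtain ⟨b₀, hb₀⟩ := exists_toAdelic_eq_of_mem_quotientSubgroup b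
    obtain ⟨n₀, hn₀⟩ := exists_toAdelic_eq_of_mem_quotientSubgroup n
    rw [Subgroup.mem_subgroupOf] at hb hn h
    rw [← hb₀, K2E1PseudoEisensteinConstantTermU.toAdelic_mem_borelAdelic_iff] at hb
    rw [← hn₀, toAdelic_mem_adelicUnipotent_iff] at hn
    have h' : (quasiSplit F E c N).toAdelic (b₀ * w * n₀) ∈ borelAdelic F E c N := by
      rw [toAdelic_mul_quasiSplit, toAdelic_mul_quasiSplit, hb₀, hn₀]; exact h
    exact hdisjR hb hn ((K2E1PseudoEisensteinConstantTermU.toAdelic_mem_borelAdelic_iff _).1 h')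
  · obtain ⟨b₀, hb₀⟩ := exists_toAdelic_eq_of_mem_quotientSubgroup b
    obtain ⟨b₀', hb₀'⟩ := exists_toAdelic_eq_of_mem_quotientSubgroup b'
    obtain ⟨n₀, hn₀⟩ := exists_toAdelic_eq_of_mem_quotientSubgroup n
    obtain ⟨n₀', hn₀'⟩ := exists_toAdelic_eq_of_mem_quotientSubgroup n'
    rw [Subgroup.mem_subgroupOf] at hb hb' hn hn'
    rw [← hb₀, K2E1PseudoEisensteinConstantTermU.toAdelic_mem_borelAdelic_iff] at hb
    rw [← hb₀', K2E1PseudoEisensteinConstantTermU.toAdelic_mem_borelAdelic_iff] at hb'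
    rw [← hn₀, toAdelic_mem_adelicUnipotent_iff] at hn
    rw [← hn₀', toAdelic_mem_adelicUnipotent_iff] at hn'
    have h' : (quasiSplit F E c N).toAdelic (b₀ * w * n₀) = (quasiSplit F E c N).toAdelic (b₀' * w * n₀') := by
      rw [toAdelic_mul_quasiSplit, toAdelic_mul_quasiSplit, toAdelic_mul_quasiSplit, toAdelic_mul_quasiSplit, hb₀, hn₀, hb₀', hn₀']
      exact congrArg (fun z : (quasiSplit F E c N).quotientSubgroup => (z : (quasiSplit F E c N).Adelic)) h
    obtain ⟨h1, h2⟩ := huniqR hb hb' hn hn' (toAdelic_injective_quasiSplit h')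
    subst h1; subst h2
    exact ⟨Subtype.ext (hb₀.symm.trans hb₀'), Subtype.ext (hn₀.symm.trans hn₀')⟩

end Bruhat

/-! ## §2 The Eisenstein constant term on `U(J_N)(𝔸_F)` from the rational Bruhat trichotomy (every `N`) -/

section Instance

/-- **`E_B(φ) = φ + M(w₀)φ` ON MOK'S `U(J_N)`, FROM THE RATIONAL BRUHAT TRICHOTOMY** (`[0,∞]`, every `N`; the trichotomy is ★ for `N = 2, 3`, §3): for `Γ = G(F)`,
`N(𝔸_F) = adelicUnipotent`, `B(F) = borelAdelic ⊓ Γ`, a left- and inversion-invariant `ν` on `N(𝔸_F)`, a measurable fundamental domain `𝓕` of `N(F)` (★ `rationalUnipotent`), a Borel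
`φ ≥ 0` right-invariant under `N(𝔸_F)` and under `B(F)`, and `x ∈ U(J_N)(𝔸_F)`:
`∫⁻_{u∈𝓕} E_φ(x u⁻¹) dν = ν(𝓕)·φ(x) + ∫⁻_{N(𝔸)} φ(x v ι(w)⁻¹) dν(v)`, `E_φ(g) = Σ'_{q ∈ Γ⧸B(F)} φ(g q̃)`. [cite: MoeglinWaldspurger1995, II.1.7] [cite: Rogawski1990, §2.1] -/
theorem setLIntegral_tsum_borelQuotient_eq_quasiSplit_of_rational (w : ↥(unitaryGroupOfForm (c : E →+* E) ((StdForm.antidiagonal N).over E)))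
    (hexR : ∀ g : ↥(unitaryGroupOfForm (c : E →+* E) ((StdForm.antidiagonal N).over E)),
      g ∈ borelU (c : E →+* E) ((StdForm.antidiagonal N).over E) ∨ ∃ b ∈ borelU (c : E →+* E) ((StdForm.antidiagonal N).over E),
        ∃ n ∈ unipotentU (c : E →+* E) ((StdForm.antidiagonal N).over E), g = b * w * n)
    (hdisjR : ∀ ⦃b n : ↥(unitaryGroupOfForm (c : E →+* E) ((StdForm.antidiagonal N).over E))⦄, b ∈ borelU (c : E →+* E) ((StdForm.antidiagonal N).over E) →
      n ∈ unipotentU (c : E →+* E) ((StdForm.antidiagonal N).over E) → b * w * n ∉ borelU (c : E →+* E) ((StdForm.antidiagonal N).over E))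
    (huniqR : ∀ ⦃b b' n n' : ↥(unitaryGroupOfForm (c : E →+* E) ((StdForm.antidiagonal N).over E))⦄,
      b ∈ borelU (c : E →+* E) ((StdForm.antidiagonal N).over E) → b' ∈ borelU (c : E →+* E) ((StdForm.antidiagonal N).over E) →
      n ∈ unipotentU (c : E →+* E) ((StdForm.antidiagonal N).over E) → n' ∈ unipotentU (c : E →+* E) ((StdForm.antidiagonal N).over E) →
      b * w * n = b' * w * n' → b = b' ∧ n = n')
    [MeasurableSpace (quasiSplit F E c N).Adelic] [BorelSpace (quasiSplit F E c N).Adelic]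
    (νN : Measure ↥(adelicUnipotent F E c N)) [νN.IsMulLeftInvariant] [νN.IsInvInvariant]
    {φ : (quasiSplit F E c N).Adelic → ℝ≥0∞} (hφm : Measurable φ) (hφN : ∀ (g : (quasiSplit F E c N).Adelic) (n : ↥(adelicUnipotent F E c N)), φ (g * n) = φ g)
    (hφB : ∀ (g : (quasiSplit F E c N).Adelic) (b : (quasiSplit F E c N).quotientSubgroup),
      b ∈ (borelAdelic F E c N).subgroupOf (quasiSplit F E c N).quotientSubgroup → φ (g * (b : (quasiSplit F E c N).Adelic)) = φ g)
    {𝓕 : Set ↥(adelicUnipotent F E c N)} (h𝓕 : IsFundamentalDomain ↥(rationalUnipotent F E c N) 𝓕 νN) (x : (quasiSplit F E c N).Adelic) :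
    ∫⁻ u in 𝓕, (∑' q : (quasiSplit F E c N).quotientSubgroup ⧸ (borelAdelic F E c N).subgroupOf (quasiSplit F E c N).quotientSubgroup,
        φ (x * (u : (quasiSplit F E c N).Adelic)⁻¹ * ((q.out : (quasiSplit F E c N).quotientSubgroup) : (quasiSplit F E c N).Adelic))) ∂νN =
      νN 𝓕 * φ x + ∫⁻ v : ↥(adelicUnipotent F E c N), φ (x * (v : (quasiSplit F E c N).Adelic) * ((quasiSplit F E c N).toAdelic w)⁻¹) ∂νN := by
  haveI : DiscreteTopology (quasiSplit F E c N).quotientSubgroup := by rw [quotientSubgroup_quasiSplit]; exact isDiscreteRational_quasiSplit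
  haveI := secondCountableTopology_adeleRing E
  haveI : SecondCountableTopology (quasiSplit F E c N).Adelic := inferInstanceAs (SecondCountableTopology (adelic F E c N ((StdForm.antidiagonal N).over E)))
  have hΓN : ((quasiSplit F E c N).quotientSubgroup).subgroupOf (adelicUnipotent F E c N) = rationalUnipotent F E c N := by
    rw [quotientSubgroup_quasiSplit]; rfl
  have h𝓕' : IsFundamentalDomain ↥(((quasiSplit F E c N).quotientSubgroup).subgroupOf (adelicUnipotent F E c N)) 𝓕 νN := by rw [hΓN]; exact h𝓕
  obtain ⟨hex, hdisj, huniq⟩ := bruhat_quotientSubgroup_of_rational (F := F) w hexR hdisjR huniqR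
  obtain ⟨e, he₁, he₂⟩ := exists_equiv_option_quotient_borel hex hdisj huniq
  exact setLIntegral_tsum_borelQuotient_eq ((quasiSplit F E c N).quotientSubgroup) (adelicUnipotent F E c N) νN hφm hφN hφB e he₁ he₂ h𝓕' x

/-- **THE `ℂ` TWIN** of the previous theorem, under the finiteness binder `∫⁻_{u∈𝓕} E_{‖φ‖}(x u⁻¹) dν < ∞`:
`∫_{u∈𝓕} E_φ(x u⁻¹) dν = (ν 𝓕).toReal • φ(x) + ∫_{N(𝔸)} φ(x v ι(w)⁻¹) dν(v)`. [cite: MoeglinWaldspurger1995, II.1.7] [cite: Rogawski1990, §2.1] -/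
theorem setIntegral_tsum_borelQuotient_eq_quasiSplit_of_rational (w : ↥(unitaryGroupOfForm (c : E →+* E) ((StdForm.antidiagonal N).over E)))
    (hexR : ∀ g : ↥(unitaryGroupOfForm (c : E →+* E) ((StdForm.antidiagonal N).over E)),
      g ∈ borelU (c : E →+* E) ((StdForm.antidiagonal N).over E) ∨ ∃ b ∈ borelU (c : E →+* E) ((StdForm.antidiagonal N).over E),
        ∃ n ∈ unipotentU (c : E →+* E) ((StdForm.antidiagonal N).over E), g = b * w * n)
    (hdisjR : ∀ ⦃b n : ↥(unitaryGroupOfForm (c : E →+* E) ((StdForm.antidiagonal N).over E))⦄, b ∈ borelU (c : E →+* E) ((StdForm.antidiagonal N).over E) →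
      n ∈ unipotentU (c : E →+* E) ((StdForm.antidiagonal N).over E) → b * w * n ∉ borelU (c : E →+* E) ((StdForm.antidiagonal N).over E))
    (huniqR : ∀ ⦃b b' n n' : ↥(unitaryGroupOfForm (c : E →+* E) ((StdForm.antidiagonal N).over E))⦄,
      b ∈ borelU (c : E →+* E) ((StdForm.antidiagonal N).over E) → b' ∈ borelU (c : E →+* E) ((StdForm.antidiagonal N).over E) →
      n ∈ unipotentU (c : E →+* E) ((StdForm.antidiagonal N).over E) → n' ∈ unipotentU (c : E →+* E) ((StdForm.antidiagonal N).over E) →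
      b * w * n = b' * w * n' → b = b' ∧ n = n')
    [MeasurableSpace (quasiSplit F E c N).Adelic] [BorelSpace (quasiSplit F E c N).Adelic]
    (νN : Measure ↥(adelicUnipotent F E c N)) [νN.IsMulLeftInvariant] [νN.IsInvInvariant]
    {φ : (quasiSplit F E c N).Adelic → ℂ} (hφm : Measurable φ) (hφN : ∀ (g : (quasiSplit F E c N).Adelic) (n : ↥(adelicUnipotent F E c N)), φ (g * n) = φ g)
    (hφB : ∀ (g : (quasiSplit F E c N).Adelic) (b : (quasiSplit F E c N).quotientSubgroup),
      b ∈ (borelAdelic F E c N).subgroupOf (quasiSplit F E c N).quotientSubgroup → φ (g * (b : (quasiSplit F E c N).Adelic)) = φ g)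
    {𝓕 : Set ↥(adelicUnipotent F E c N)} (h𝓕 : IsFundamentalDomain ↥(rationalUnipotent F E c N) 𝓕 νN) (x : (quasiSplit F E c N).Adelic)
    (hfin : ∫⁻ u in 𝓕, (∑' q : (quasiSplit F E c N).quotientSubgroup ⧸ (borelAdelic F E c N).subgroupOf (quasiSplit F E c N).quotientSubgroup,
        ‖φ (x * (u : (quasiSplit F E c N).Adelic)⁻¹ * ((q.out : (quasiSplit F E c N).quotientSubgroup) : (quasiSplit F E c N).Adelic))‖ₑ) ∂νN < ∞) :
    ∫ u in 𝓕, (∑' q : (quasiSplit F E c N).quotientSubgroup ⧸ (borelAdelic F E c N).subgroupOf (quasiSplit F E c N).quotientSubgroup,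
        φ (x * (u : (quasiSplit F E c N).Adelic)⁻¹ * ((q.out : (quasiSplit F E c N).quotientSubgroup) : (quasiSplit F E c N).Adelic))) ∂νN =
      (νN 𝓕).toReal • φ x + ∫ v : ↥(adelicUnipotent F E c N), φ (x * (v : (quasiSplit F E c N).Adelic) * ((quasiSplit F E c N).toAdelic w)⁻¹) ∂νN := by
  haveI : DiscreteTopology (quasiSplit F E c N).quotientSubgroup := by rw [quotientSubgroup_quasiSplit]; exact isDiscreteRational_quasiSplit
  haveI := secondCountableTopology_adeleRing E
  haveI : SecondCountableTopology (quasiSplit F E c N).Adelic := inferInstanceAs (SecondCountableTopology (adelic F E c N ((StdForm.antidiagonal N).over E)))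
  have hΓN : ((quasiSplit F E c N).quotientSubgroup).subgroupOf (adelicUnipotent F E c N) = rationalUnipotent F E c N := by
    rw [quotientSubgroup_quasiSplit]; rfl
  have h𝓕' : IsFundamentalDomain ↥(((quasiSplit F E c N).quotientSubgroup).subgroupOf (adelicUnipotent F E c N)) 𝓕 νN := by rw [hΓN]; exact h𝓕
  obtain ⟨hex, hdisj, huniq⟩ := bruhat_quotientSubgroup_of_rational (F := F) w hexR hdisjR huniqR
  obtain ⟨e, he₁, he₂⟩ := exists_equiv_option_quotient_borel hex hdisj huniq
  exact setIntegral_tsum_borelQuotient_eq ((quasiSplit F E c N).quotientSubgroup) (adelicUnipotent F E c N) νN hφm hφN hφB e he₁ he₂ h𝓕' x hfin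

end Instance

/-! ## §3 The instances `U(J₂)`, `U(J₃)` -/

section Instances

/-- **`E_B(φ) = φ + M(w₀)φ` ON `U(J₂)(𝔸_F)`** (`[0,∞]`; any `E∕F`, any `c`; `w₀ = J₂` ★ `weylLongU`): for a left- and inversion-invariant `ν` on `N(𝔸_F)`, a measurable
fundamental domain `𝓕` of `N(F)`, a Borel `φ ≥ 0` right-invariant under `N(𝔸_F)` and under `B(F) = borelAdelic ⊓ Γ`, and `x ∈ U(J₂)(𝔸_F)`:
`∫⁻_{u∈𝓕} E_φ(x u⁻¹) dν = ν(𝓕)·φ(x) + ∫⁻_{N(𝔸)} φ(x v ι(w₀)⁻¹) dν(v)` (★ rational Bruhat `U2LocalBruhatDecomposition`). [cite: MoeglinWaldspurger1995, II.1.7] [cite: Rogawski1990, §1.10, §2.1] -/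
theorem setLIntegral_tsum_borelQuotient_eq_quasiSplit_two [MeasurableSpace (quasiSplit F E c 2).Adelic] [BorelSpace (quasiSplit F E c 2).Adelic]
    (νN : Measure ↥(adelicUnipotent F E c 2)) [νN.IsMulLeftInvariant] [νN.IsInvInvariant]
    {φ : (quasiSplit F E c 2).Adelic → ℝ≥0∞} (hφm : Measurable φ) (hφN : ∀ (g : (quasiSplit F E c 2).Adelic) (n : ↥(adelicUnipotent F E c 2)), φ (g * n) = φ g)
    (hφB : ∀ (g : (quasiSplit F E c 2).Adelic) (b : (quasiSplit F E c 2).quotientSubgroup),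
      b ∈ (borelAdelic F E c 2).subgroupOf (quasiSplit F E c 2).quotientSubgroup → φ (g * (b : (quasiSplit F E c 2).Adelic)) = φ g)
    {𝓕 : Set ↥(adelicUnipotent F E c 2)} (h𝓕 : IsFundamentalDomain ↥(rationalUnipotent F E c 2) 𝓕 νN) (x : (quasiSplit F E c 2).Adelic) :
    ∫⁻ u in 𝓕, (∑' q : (quasiSplit F E c 2).quotientSubgroup ⧸ (borelAdelic F E c 2).subgroupOf (quasiSplit F E c 2).quotientSubgroup,
        φ (x * (u : (quasiSplit F E c 2).Adelic)⁻¹ * ((q.out : (quasiSplit F E c 2).quotientSubgroup) : (quasiSplit F E c 2).Adelic))) ∂νN =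
      νN 𝓕 * φ x + ∫⁻ v : ↥(adelicUnipotent F E c 2), φ (x * (v : (quasiSplit F E c 2).Adelic) *
        ((quasiSplit F E c 2).toAdelic (weylLongU (c : E →+* E) (rfl : (StdForm.antidiagonal 2).over E = (StdForm.antidiagonal 2).over E)))⁻¹) ∂νN :=
  setLIntegral_tsum_borelQuotient_eq_quasiSplit_of_rational (weylLongU (c : E →+* E) rfl) (mem_borelU_or_exists_eq_mul_weylLongU_mul_two (c : E →+* E) rfl)
    (fun _ _ hb hn => mul_weylLongU_mul_not_mem_borelU_two (c : E →+* E) rfl hb hn)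
    (fun _ _ _ _ hb hb' hn hn' h => eq_of_mul_weylLongU_mul_eq_two (c : E →+* E) rfl hb hb' hn hn' h) νN hφm hφN hφB h𝓕 x

/-- **`E_B(φ) = φ + M(w₀)φ` ON `U(J₂)(𝔸_F)`, `ℂ`-VALUED**, under `∫⁻_{u∈𝓕} E_{‖φ‖}(x u⁻¹) dν < ∞`:
`∫_{u∈𝓕} E_φ(x u⁻¹) dν = (ν 𝓕).toReal • φ(x) + ∫_{N(𝔸)} φ(x v ι(w₀)⁻¹) dν(v)`. [cite: MoeglinWaldspurger1995, II.1.7] [cite: Rogawski1990, §1.10, §2.1] -/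
theorem setIntegral_tsum_borelQuotient_eq_quasiSplit_two [MeasurableSpace (quasiSplit F E c 2).Adelic] [BorelSpace (quasiSplit F E c 2).Adelic]
    (νN : Measure ↥(adelicUnipotent F E c 2)) [νN.IsMulLeftInvariant] [νN.IsInvInvariant]
    {φ : (quasiSplit F E c 2).Adelic → ℂ} (hφm : Measurable φ) (hφN : ∀ (g : (quasiSplit F E c 2).Adelic) (n : ↥(adelicUnipotent F E c 2)), φ (g * n) = φ g)
    (hφB : ∀ (g : (quasiSplit F E c 2).Adelic) (b : (quasiSplit F E c 2).quotientSubgroup),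
      b ∈ (borelAdelic F E c 2).subgroupOf (quasiSplit F E c 2).quotientSubgroup → φ (g * (b : (quasiSplit F E c 2).Adelic)) = φ g)
    {𝓕 : Set ↥(adelicUnipotent F E c 2)} (h𝓕 : IsFundamentalDomain ↥(rationalUnipotent F E c 2) 𝓕 νN) (x : (quasiSplit F E c 2).Adelic)
    (hfin : ∫⁻ u in 𝓕, (∑' q : (quasiSplit F E c 2).quotientSubgroup ⧸ (borelAdelic F E c 2).subgroupOf (quasiSplit F E c 2).quotientSubgroup,
        ‖φ (x * (u : (quasiSplit F E c 2).Adelic)⁻¹ * ((q.out : (quasiSplit F E c 2).quotientSubgroup) : (quasiSplit F E c 2).Adelic))‖ₑ) ∂νN < ∞) :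
    ∫ u in 𝓕, (∑' q : (quasiSplit F E c 2).quotientSubgroup ⧸ (borelAdelic F E c 2).subgroupOf (quasiSplit F E c 2).quotientSubgroup,
        φ (x * (u : (quasiSplit F E c 2).Adelic)⁻¹ * ((q.out : (quasiSplit F E c 2).quotientSubgroup) : (quasiSplit F E c 2).Adelic))) ∂νN =
      (νN 𝓕).toReal • φ x + ∫ v : ↥(adelicUnipotent F E c 2), φ (x * (v : (quasiSplit F E c 2).Adelic) *
        ((quasiSplit F E c 2).toAdelic (weylLongU (c : E →+* E) (rfl : (StdForm.antidiagonal 2).over E = (StdForm.antidiagonal 2).over E)))⁻¹) ∂νN :=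
  setIntegral_tsum_borelQuotient_eq_quasiSplit_of_rational (weylLongU (c : E →+* E) rfl) (mem_borelU_or_exists_eq_mul_weylLongU_mul_two (c : E →+* E) rfl)
    (fun _ _ hb hn => mul_weylLongU_mul_not_mem_borelU_two (c : E →+* E) rfl hb hn)
    (fun _ _ _ _ hb hb' hn hn' h => eq_of_mul_weylLongU_mul_eq_two (c : E →+* E) rfl hb hb' hn hn' h) νN hφm hφN hφB h𝓕 x hfin

/-- **`E_B(φ) = φ + M(w₀)φ` ON `U(J₃)(𝔸_F)`** (`[0,∞]`; any `E∕F`, any `c`; `w₀ = J₃` ★ `weylLongU`): for a left- and inversion-invariant `ν` on `N(𝔸_F)`, a measurable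
fundamental domain `𝓕` of `N(F)`, a Borel `φ ≥ 0` right-invariant under `N(𝔸_F)` and under `B(F) = borelAdelic ⊓ Γ`, and `x ∈ U(J₃)(𝔸_F)`:
`∫⁻_{u∈𝓕} E_φ(x u⁻¹) dν = ν(𝓕)·φ(x) + ∫⁻_{N(𝔸)} φ(x v ι(w₀)⁻¹) dν(v)` (★ rational Bruhat `U3LocalBruhatDecompositionProofs`). [cite: MoeglinWaldspurger1995, II.1.7] [cite: Rogawski1990, §1.10, §2.1] -/
theorem setLIntegral_tsum_borelQuotient_eq_quasiSplit_three [MeasurableSpace (quasiSplit F E c 3).Adelic] [BorelSpace (quasiSplit F E c 3).Adelic]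
    (νN : Measure ↥(adelicUnipotent F E c 3)) [νN.IsMulLeftInvariant] [νN.IsInvInvariant]
    {φ : (quasiSplit F E c 3).Adelic → ℝ≥0∞} (hφm : Measurable φ) (hφN : ∀ (g : (quasiSplit F E c 3).Adelic) (n : ↥(adelicUnipotent F E c 3)), φ (g * n) = φ g)
    (hφB : ∀ (g : (quasiSplit F E c 3).Adelic) (b : (quasiSplit F E c 3).quotientSubgroup),
      b ∈ (borelAdelic F E c 3).subgroupOf (quasiSplit F E c 3).quotientSubgroup → φ (g * (b : (quasiSplit F E c 3).Adelic)) = φ g)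
    {𝓕 : Set ↥(adelicUnipotent F E c 3)} (h𝓕 : IsFundamentalDomain ↥(rationalUnipotent F E c 3) 𝓕 νN) (x : (quasiSplit F E c 3).Adelic) :
    ∫⁻ u in 𝓕, (∑' q : (quasiSplit F E c 3).quotientSubgroup ⧸ (borelAdelic F E c 3).subgroupOf (quasiSplit F E c 3).quotientSubgroup,
        φ (x * (u : (quasiSplit F E c 3).Adelic)⁻¹ * ((q.out : (quasiSplit F E c 3).quotientSubgroup) : (quasiSplit F E c 3).Adelic))) ∂νN =
      νN 𝓕 * φ x + ∫⁻ v : ↥(adelicUnipotent F E c 3), φ (x * (v : (quasiSplit F E c 3).Adelic) *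
        ((quasiSplit F E c 3).toAdelic (weylLongU (c : E →+* E) (rfl : (StdForm.antidiagonal 3).over E = (StdForm.antidiagonal 3).over E)))⁻¹) ∂νN :=
  setLIntegral_tsum_borelQuotient_eq_quasiSplit_of_rational (weylLongU (c : E →+* E) rfl) (mem_borelU_or_exists_eq_mul_weylLongU_mul (c : E →+* E) rfl)
    (fun _ _ hb hn => mul_weylLongU_mul_not_mem_borelU (c : E →+* E) rfl hb hn)
    (fun _ _ _ _ hb hb' hn hn' h => eq_of_mul_weylLongU_mul_eq (c : E →+* E) rfl hb hb' hn hn' h) νN hφm hφN hφB h𝓕 x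

/-- **`E_B(φ) = φ + M(w₀)φ` ON `U(J₃)(𝔸_F)`, `ℂ`-VALUED**, under `∫⁻_{u∈𝓕} E_{‖φ‖}(x u⁻¹) dν < ∞`:
`∫_{u∈𝓕} E_φ(x u⁻¹) dν = (ν 𝓕).toReal • φ(x) + ∫_{N(𝔸)} φ(x v ι(w₀)⁻¹) dν(v)`. [cite: MoeglinWaldspurger1995, II.1.7] [cite: Rogawski1990, §1.10, §2.1] -/
theorem setIntegral_tsum_borelQuotient_eq_quasiSplit_three [MeasurableSpace (quasiSplit F E c 3).Adelic] [BorelSpace (quasiSplit F E c 3).Adelic]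
    (νN : Measure ↥(adelicUnipotent F E c 3)) [νN.IsMulLeftInvariant] [νN.IsInvInvariant]
    {φ : (quasiSplit F E c 3).Adelic → ℂ} (hφm : Measurable φ) (hφN : ∀ (g : (quasiSplit F E c 3).Adelic) (n : ↥(adelicUnipotent F E c 3)), φ (g * n) = φ g)
    (hφB : ∀ (g : (quasiSplit F E c 3).Adelic) (b : (quasiSplit F E c 3).quotientSubgroup),
      b ∈ (borelAdelic F E c 3).subgroupOf (quasiSplit F E c 3).quotientSubgroup → φ (g * (b : (quasiSplit F E c 3).Adelic)) = φ g)
    {𝓕 : Set ↥(adelicUnipotent F E c 3)} (h𝓕 : IsFundamentalDomain ↥(rationalUnipotent F E c 3) 𝓕 νN) (x : (quasiSplit F E c 3).Adelic)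
    (hfin : ∫⁻ u in 𝓕, (∑' q : (quasiSplit F E c 3).quotientSubgroup ⧸ (borelAdelic F E c 3).subgroupOf (quasiSplit F E c 3).quotientSubgroup,
        ‖φ (x * (u : (quasiSplit F E c 3).Adelic)⁻¹ * ((q.out : (quasiSplit F E c 3).quotientSubgroup) : (quasiSplit F E c 3).Adelic))‖ₑ) ∂νN < ∞) :
    ∫ u in 𝓕, (∑' q : (quasiSplit F E c 3).quotientSubgroup ⧸ (borelAdelic F E c 3).subgroupOf (quasiSplit F E c 3).quotientSubgroup,
        φ (x * (u : (quasiSplit F E c 3).Adelic)⁻¹ * ((q.out : (quasiSplit F E c 3).quotientSubgroup) : (quasiSplit F E c 3).Adelic))) ∂νN =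
      (νN 𝓕).toReal • φ x + ∫ v : ↥(adelicUnipotent F E c 3), φ (x * (v : (quasiSplit F E c 3).Adelic) *
        ((quasiSplit F E c 3).toAdelic (weylLongU (c : E →+* E) (rfl : (StdForm.antidiagonal 3).over E = (StdForm.antidiagonal 3).over E)))⁻¹) ∂νN :=
  setIntegral_tsum_borelQuotient_eq_quasiSplit_of_rational (weylLongU (c : E →+* E) rfl) (mem_borelU_or_exists_eq_mul_weylLongU_mul (c : E →+* E) rfl)
    (fun _ _ hb hn => mul_weylLongU_mul_not_mem_borelU (c : E →+* E) rfl hb hn)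
    (fun _ _ _ _ hb hb' hn hn' h => eq_of_mul_weylLongU_mul_eq (c : E →+* E) rfl hb hb' hn hn' h) νN hφm hφN hφB h𝓕 x hfin

end Instances

end Summit.HodgeConjecture.HodgeConjecture.Cruxes.H413.K2E1EisensteinConstantTermU

end
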